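/-
Origin: expansion seat `planner-pub-hodgecm-toy2-g2-0`, handover 2026-08-18 (`HOME/pub-hodgecm-toy2-g2/lean/Toy2g2/Fp.lean`, md5 7b0d6675, 179 lines);
landed by the gen-6 packager in gate run 22 as `HodgeCM/Model/SexticCM/Fp.lean` (verbatim).
-/
/-
Copyright: pub-hodgecm formalisation cell (harness21, 2026). New file (not vendored).
Origin: HOME/pub-hodgecm-toy2-g2/lean/Toy2g2/Fp.lean (WIP module `Toy2g2.Fp`; intended final place
`HodgeCM/Model/SexticCM/Fp.lean` = module `HodgeCM.Model.SexticCM.Fp`, CONTRIBUTING §3 L5) (seat planner-pub-hodgecm-toy2-g2-0,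
consistency seat 2 gen 2, part (6a)(ii): PerL's hypotheses are inhabited — irreducibility over F_3 / F_7 of S_3, A_7, B_7 by excluding small-degree factors (decide)).
-/
import Mathlib

/-!
# Irreducibility of explicit quartics / sextics over a field by excluding small factors

Generic criteria (`irreducible_quartic`, `irreducible_sextic`): a monic quartic (sextic) with no root and no
factorisation into monic quadratics (quadratic·quartic, cubic·cubic) — phrased as the non-solvability of the
explicit coefficient equations — is irreducible.  Over `ZMod p` the hypotheses are closed by `decide`.
-/

open Polynomial

namespace HodgeCM.SexticCM.Fp

variable {R : Type*} [Field R]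

/-- (Ported verbatim from the HodgeCMPerL package; no docstring in the source.) -/
lemma monic_deg1_eq {g : R[X]} (hg : g.Monic) (h : g.natDegree = 1) : g = X + C (g.coeff 0) := by
  have := hg.as_sum; rw [h] at this; rw [this]; simp

/-- (Ported verbatim from the HodgeCMPerL package; no docstring in the source.) -/
lemma monic_deg2_eq {g : R[X]} (hg : g.Monic) (h : g.natDegree = 2) :
    g = X ^ 2 + C (g.coeff 1) * X + C (g.coeff 0) := by
  have := hg.as_sum; rw [h] at this; rw [this]; simp [Finset.sum_range_succ]; ring

/-- (Ported verbatim from the HodgeCMPerL package; no docstring in the source.) -/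
lemma monic_deg3_eq {g : R[X]} (hg : g.Monic) (h : g.natDegree = 3) :
    g = X ^ 3 + C (g.coeff 2) * X ^ 2 + C (g.coeff 1) * X + C (g.coeff 0) := by
  have := hg.as_sum; rw [h] at this; rw [this]; simp [Finset.sum_range_succ]; ring

/-- (Ported verbatim from the HodgeCMPerL package; no docstring in the source.) -/
lemma monic_deg4_eq {g : R[X]} (hg : g.Monic) (h : g.natDegree = 4) :
    g = X ^ 4 + C (g.coeff 3) * X ^ 3 + C (g.coeff 2) * X ^ 2 + C (g.coeff 1) * X + C (g.coeff 0) := by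
  have := hg.as_sum; rw [h] at this; rw [this]; simp [Finset.sum_range_succ]; ring

/-- a monic factorisation with a linear factor gives a root -/
lemma root_of_deg1_factor {P f g : R[X]} (hg : g.Monic) (h1 : g.natDegree = 1) (hfg : f * g = P) :
    P.eval (-(g.coeff 0)) = 0 := by
  rw [← hfg, eval_mul, monic_deg1_eq hg h1]; simp

/-- (Ported verbatim from the HodgeCMPerL package; no docstring in the source.) -/
theorem irreducible_quartic (a3 a2 a1 a0 : R)
    (hroot : ∀ x : R, x ^ 4 + a3 * x ^ 3 + a2 * x ^ 2 + a1 * x + a0 ≠ 0)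
    (h22 : ∀ f1 f0 g1 g0 : R,
      ¬ (f1 + g1 = a3 ∧ f0 + f1 * g1 + g0 = a2 ∧ f1 * g0 + f0 * g1 = a1 ∧ f0 * g0 = a0)) :
    Irreducible (X ^ 4 + C a3 * X ^ 3 + C a2 * X ^ 2 + C a1 * X + C a0 : R[X]) := by
  set P : R[X] := X ^ 4 + C a3 * X ^ 3 + C a2 * X ^ 2 + C a1 * X + C a0 with hPdef
  have hP : P.Monic := by rw [hPdef]; monicity!
  have hdeg : P.natDegree = 4 := by rw [hPdef]; compute_degree!
  rw [hP.irreducible_iff_natDegree']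
  refine ⟨fun h => ?_, fun f g hf hg hfg => ?_⟩
  · have := congrArg natDegree h; rw [hdeg] at this; simp at this
  · rw [hdeg, Finset.mem_Ioc]
    rintro ⟨h0, h2⟩
    have hsum : f.natDegree + g.natDegree = 4 := by rw [← hf.natDegree_mul hg, hfg, hdeg]
    interval_cases hgd : g.natDegree
    · apply hroot (-(g.coeff 0))
      have := root_of_deg1_factor hg hgd hfg
      simpa [hPdef] using this
    · have hfd : f.natDegree = 2 := by omega
      rw [monic_deg2_eq hf hfd, monic_deg2_eq hg hgd] at hfg
      have key : (X ^ 2 + C (f.coeff 1) * X + C (f.coeff 0)) * (X ^ 2 + C (g.coeff 1) * X + C (g.coeff 0))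
          = X ^ 4 + C (f.coeff 1 + g.coeff 1) * X ^ 3 + C (f.coeff 0 + f.coeff 1 * g.coeff 1 + g.coeff 0) * X ^ 2
            + C (f.coeff 1 * g.coeff 0 + f.coeff 0 * g.coeff 1) * X + C (f.coeff 0 * g.coeff 0) := by
        simp only [map_add, map_mul]; ring
      rw [key, hPdef] at hfg
      apply h22 (f.coeff 1) (f.coeff 0) (g.coeff 1) (g.coeff 0)
      have c3 := congrArg (coeff · 3) hfg
      have c2 := congrArg (coeff · 2) hfg
      have c1 := congrArg (coeff · 1) hfg
      have c0 := congrArg (coeff · 0) hfg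
      simp only [coeff_add, coeff_C_mul, coeff_X_pow, coeff_C, coeff_X] at c3 c2 c1 c0
      norm_num at c3 c2 c1 c0
      exact ⟨c3, c2, c1, c0⟩

/-- (Ported verbatim from the HodgeCMPerL package; no docstring in the source.) -/
theorem irreducible_sextic (a5 a4 a3 a2 a1 a0 : R)
    (hroot : ∀ x : R, x ^ 6 + a5 * x ^ 5 + a4 * x ^ 4 + a3 * x ^ 3 + a2 * x ^ 2 + a1 * x + a0 ≠ 0)
    (h42 : ∀ f3 f2 f1 f0 g1 g0 : R,
      ¬ (f3 + g1 = a5 ∧ f2 + f3 * g1 + g0 = a4 ∧ f1 + f2 * g1 + f3 * g0 = a3 ∧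
         f0 + f1 * g1 + f2 * g0 = a2 ∧ f0 * g1 + f1 * g0 = a1 ∧ f0 * g0 = a0))
    (h33 : ∀ f2 f1 f0 g2 g1 g0 : R,
      ¬ (f2 + g2 = a5 ∧ f1 + f2 * g2 + g1 = a4 ∧ f0 + f2 * g1 + f1 * g2 + g0 = a3 ∧
         f2 * g0 + f1 * g1 + f0 * g2 = a2 ∧ f1 * g0 + f0 * g1 = a1 ∧ f0 * g0 = a0)) :
    Irreducible (X ^ 6 + C a5 * X ^ 5 + C a4 * X ^ 4 + C a3 * X ^ 3 + C a2 * X ^ 2 + C a1 * X + C a0 : R[X]) := by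
  set P : R[X] := X ^ 6 + C a5 * X ^ 5 + C a4 * X ^ 4 + C a3 * X ^ 3 + C a2 * X ^ 2 + C a1 * X + C a0
    with hPdef
  have hP : P.Monic := by rw [hPdef]; monicity!
  have hdeg : P.natDegree = 6 := by rw [hPdef]; compute_degree!
  rw [hP.irreducible_iff_natDegree']
  refine ⟨fun h => ?_, fun f g hf hg hfg => ?_⟩
  · have := congrArg natDegree h; rw [hdeg] at this; simp at this
  · rw [hdeg, Finset.mem_Ioc]
    rintro ⟨h0, h3⟩
    have hsum : f.natDegree + g.natDegree = 6 := by rw [← hf.natDegree_mul hg, hfg, hdeg]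
    interval_cases hgd : g.natDegree
    · apply hroot (-(g.coeff 0))
      have := root_of_deg1_factor hg hgd hfg
      simpa [hPdef] using this
    · have hfd : f.natDegree = 4 := by omega
      rw [monic_deg4_eq hf hfd, monic_deg2_eq hg hgd] at hfg
      have key : (X ^ 4 + C (f.coeff 3) * X ^ 3 + C (f.coeff 2) * X ^ 2 + C (f.coeff 1) * X + C (f.coeff 0))
          * (X ^ 2 + C (g.coeff 1) * X + C (g.coeff 0))
          = X ^ 6 + C (f.coeff 3 + g.coeff 1) * X ^ 5 + C (f.coeff 2 + f.coeff 3 * g.coeff 1 + g.coeff 0) * X ^ 4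
            + C (f.coeff 1 + f.coeff 2 * g.coeff 1 + f.coeff 3 * g.coeff 0) * X ^ 3
            + C (f.coeff 0 + f.coeff 1 * g.coeff 1 + f.coeff 2 * g.coeff 0) * X ^ 2
            + C (f.coeff 0 * g.coeff 1 + f.coeff 1 * g.coeff 0) * X + C (f.coeff 0 * g.coeff 0) := by
        simp only [map_add, map_mul]; ring
      rw [key, hPdef] at hfg
      apply h42 (f.coeff 3) (f.coeff 2) (f.coeff 1) (f.coeff 0) (g.coeff 1) (g.coeff 0)
      have c5 := congrArg (coeff · 5) hfg
      have c4 := congrArg (coeff · 4) hfg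
      have c3 := congrArg (coeff · 3) hfg
      have c2 := congrArg (coeff · 2) hfg
      have c1 := congrArg (coeff · 1) hfg
      have c0 := congrArg (coeff · 0) hfg
      simp only [coeff_add, coeff_C_mul, coeff_X_pow, coeff_C, coeff_X] at c5 c4 c3 c2 c1 c0
      norm_num at c5 c4 c3 c2 c1 c0
      exact ⟨c5, c4, c3, c2, c1, c0⟩
    · have hfd : f.natDegree = 3 := by omega
      rw [monic_deg3_eq hf hfd, monic_deg3_eq hg hgd] at hfg
      have key : (X ^ 3 + C (f.coeff 2) * X ^ 2 + C (f.coeff 1) * X + C (f.coeff 0))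
          * (X ^ 3 + C (g.coeff 2) * X ^ 2 + C (g.coeff 1) * X + C (g.coeff 0))
          = X ^ 6 + C (f.coeff 2 + g.coeff 2) * X ^ 5 + C (f.coeff 1 + f.coeff 2 * g.coeff 2 + g.coeff 1) * X ^ 4
            + C (f.coeff 0 + f.coeff 2 * g.coeff 1 + f.coeff 1 * g.coeff 2 + g.coeff 0) * X ^ 3
            + C (f.coeff 2 * g.coeff 0 + f.coeff 1 * g.coeff 1 + f.coeff 0 * g.coeff 2) * X ^ 2
            + C (f.coeff 1 * g.coeff 0 + f.coeff 0 * g.coeff 1) * X + C (f.coeff 0 * g.coeff 0) := by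
        simp only [map_add, map_mul]; ring
      rw [key, hPdef] at hfg
      apply h33 (f.coeff 2) (f.coeff 1) (f.coeff 0) (g.coeff 2) (g.coeff 1) (g.coeff 0)
      have c5 := congrArg (coeff · 5) hfg
      have c4 := congrArg (coeff · 4) hfg
      have c3 := congrArg (coeff · 3) hfg
      have c2 := congrArg (coeff · 2) hfg
      have c1 := congrArg (coeff · 1) hfg
      have c0 := congrArg (coeff · 0) hfg
      simp only [coeff_add, coeff_C_mul, coeff_X_pow, coeff_C, coeff_X] at c5 c4 c3 c2 c1 c0
      norm_num at c5 c4 c3 c2 c1 c0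
      exact ⟨c5, c4, c3, c2, c1, c0⟩

/-! ### The three explicit polynomials -/

/-- (Ported verbatim from the HodgeCMPerL package; no docstring in the source.) -/
instance fact_prime_seven : Fact (Nat.Prime 7) := ⟨by norm_num⟩

/-- `S₃ = X⁶ + 2X⁴ + 1 ∈ 𝔽₃[X]` -/
noncomputable def S3 : (ZMod 3)[X] := X ^ 6 + C 0 * X ^ 5 + C 2 * X ^ 4 + C 0 * X ^ 3 + C 0 * X ^ 2 + C 0 * X + C 1

/-- `A₇ = X⁴ + 5X³ + X + 4 ∈ 𝔽₇[X]` -/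
noncomputable def A7 : (ZMod 7)[X] := X ^ 4 + C 5 * X ^ 3 + C 0 * X ^ 2 + C 1 * X + C 4

/-- `B₇ = X⁴ + 2X³ + 6X + 4 ∈ 𝔽₇[X]` -/
noncomputable def B7 : (ZMod 7)[X] := X ^ 4 + C 2 * X ^ 3 + C 0 * X ^ 2 + C 6 * X + C 4

set_option maxRecDepth 4000 in
/-- (Ported verbatim from the HodgeCMPerL package; no docstring in the source.) -/
theorem S3_irreducible : Irreducible S3 := by
  apply irreducible_sextic <;> decide

set_option maxRecDepth 4000 in
/-- (Ported verbatim from the HodgeCMPerL package; no docstring in the source.) -/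
theorem A7_irreducible : Irreducible A7 := by
  apply irreducible_quartic <;> decide

set_option maxRecDepth 4000 in
/-- (Ported verbatim from the HodgeCMPerL package; no docstring in the source.) -/
theorem B7_irreducible : Irreducible B7 := by
  apply irreducible_quartic <;> decide

/-- (Ported verbatim from the HodgeCMPerL package; no docstring in the source.) -/
lemma S3_monic : S3.Monic := by unfold S3; monicity!
/-- (Ported verbatim from the HodgeCMPerL package; no docstring in the source.) -/
lemma A7_monic : A7.Monic := by unfold A7; monicity!
/-- (Ported verbatim from the HodgeCMPerL package; no docstring in the source.) -/
lemma B7_monic : B7.Monic := by unfold B7; monicity!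
/-- (Ported verbatim from the HodgeCMPerL package; no docstring in the source.) -/
lemma S3_natDegree : S3.natDegree = 6 := by unfold S3; compute_degree!
/-- (Ported verbatim from the HodgeCMPerL package; no docstring in the source.) -/
lemma A7_natDegree : A7.natDegree = 4 := by unfold A7; compute_degree!
/-- (Ported verbatim from the HodgeCMPerL package; no docstring in the source.) -/
lemma B7_natDegree : B7.natDegree = 4 := by unfold B7; compute_degree!

/-- (Ported verbatim from the HodgeCMPerL package; no docstring in the source.) -/
lemma A7_ne_B7 : A7 ≠ B7 := by
  intro h
  have := congrArg (coeff · 3) h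
  simp [A7, B7, coeff_X, coeff_X_pow] at this
  revert this; decide

end HodgeCM.SexticCM.Fp
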